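import Summits.ValiantsHypothesis.ValiantsHypothesis.Theorems.SymPencilPerFourInnerRankTenPairs

/-!
# Route `SymPencil` — inner rank of the `2 | 2` row split of `per_4`, VII: **inner rank `≥ 10`**
# (`--supports` stmt-ValiantsHypothesis-5674 `SdcSuperquadratic`; kills the cell `(8, 8, 9)` of
# the size `m = 26` in the kernel-package table of `Cruxes/SdcSuperquadratic/NEXT-RUNG-25.md`;
# rung currency only)

**Theorem** (`false_of_joint_nine_squares`, `not_exists_joint_nine_squares`).  Over a field of
characteristic `0` there are no `c : ι → K`, `|ι| ≤ 9`, and bilinear forms `t_r((a,b),(y₂,y₃))`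
with `Σ_r c_r t_r((a,b),(y₂,y₃))² = per (a; b; y₂; y₃)` identically: the biquadratic form `per_4`
of the `2 | 2` row split is not a weighted sum of NINE squares of bilinear forms (inner rank
`≥ 10`; `≤ 12` by the Laplace design of the tree's `sdc(per_4) ≤ 29`).

Proof = the eight-square proof (`SymPencilPerFourInnerRankNine`) with one change: the kernel
vector on the base family comes from `SymPencilPerFourInnerRankKernel.ker_ne_bot_of_radical_pair`
(two independent radical vectors `(k,0)`, `(0,k)` versus an `8`-dimensional image in `K^ι`,
`|ι| ≤ 9`) instead of the surjectivity argument; zero weights are discarded first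
(`false_of_joint_of_ne_zero` → `false_of_joint_nine_squares`).  The pure case is excluded by the
rank count `6 ≤ |ι| - 6`, which would in fact fail for every `|ι| ≤ 11`; what is missing for
`|ι| ∈ {10, 11}` (cells `(8,8,10)`, `(8,8,11)` of `m = 27, 28`) is a kernel-existence lemma.

Honest framing: kills ONE cell of the size-`26` table (with `(9,7,7)` already dead by
`SymPencilPerFourLowRankSevenSharp`, the size `26` still needs the `6`-dimensional cell with `5`
squares and the one-row cell `(12,4,1)`, besides the size-`25` cells `(10,6,4)` and `(12,4,0)`);
`sdc(per_4) ≥ 25` remains the tree's value; the crux `SdcSuperquadratic` (a bound past the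
number-of-variables wall) and `VP ≠ VNP` are untouched.  No definitions, no named facts.
[folklore]
-/

noncomputable section

-- single-conjunct layout: Sub = Summit, duplicated namespace component intended
set_option linter.dupNamespace false

namespace Summit.ValiantsHypothesis.ValiantsHypothesis.Theorems.SymPencilPerFourInnerRankTen

open Matrix Finset Module
open Summit.ValiantsHypothesis.ValiantsHypothesis.Theorems.SymPencilPerFourInnerRankRows
open Summit.ValiantsHypothesis.ValiantsHypothesis.Theorems.SymPencilPerFourInnerRankTenFamily
open Summit.ValiantsHypothesis.ValiantsHypothesis.Theorems.SymPencilPerFourInnerRankTenPairs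

variable {K : Type*} [Field K] {ι : Type*} [Fintype ι]

/-! ### The pure case -/

/-- **The pure case is impossible.**  If all columns have type `X` (the `y₂`-block of `t` depends
only on `b`, the `y₃`-block only on `a`), the vectors `n_{jk} = t((0,e_j),(e_k,0)) ∈ K⁸` span a
`6`-dimensional totally isotropic subspace for `⟨x,y⟩ = Σ c_r x_r y_r` paired perfectly with the
`m_{il} = t((e_i,0),(0,e_l))`: rank contradiction.  See the module docstring. [folklore] -/
theorem false_of_allX [CharZero K] [DecidableEq ι] (hι : Fintype.card ι ≤ 9) (c : ι → K)
    (hc : ∀ r, c r ≠ 0)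
    (t : ι → (((Fin 4 → K) × (Fin 4 → K)) →ₗ[K] ((Fin 4 → K) × (Fin 4 → K)) →ₗ[K] K))
    (hJ : ∀ a b y₂ y₃ : Fin 4 → K,
      ∑ r, c r * (t r (a, b) (y₂, y₃)) ^ 2 = (Matrix.of ![a, b, y₂, y₃]).permanent)
    (hX : ∀ k : Fin 4, (∀ (a : Fin 4 → K) r, t r (a, 0) (Pi.single k 1, 0) = 0) ∧
        (∀ (b : Fin 4 → K) r, t r (0, b) (0, Pi.single k 1) = 0)) : False := by
  have hsplit : ∀ (a b : Fin 4 → K) (y : (Fin 4 → K) × (Fin 4 → K)) r,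
      t r (a, b) y = t r (a, 0) y + t r (0, b) y := fun a b y r => by
    rw [← LinearMap.add_apply, ← map_add]; simp
  -- in the pure case every pair is in the first family alternative
  have hFA : ∀ i j : Fin 4, i ≠ j →
      (∀ r, t r (0, Pi.single i 1) (Pi.single i 1, 0) = 0) ∧
      (∀ r, t r (0, Pi.single j 1) (Pi.single i 1, 0) = t r (0, Pi.single i 1) (Pi.single j 1, 0)) := by
    intro i j hij
    rcases family_pair hι c hc t hJ i j hij with ⟨-, -, h3, -, h5⟩ | ⟨hBi, -, -⟩
    · exact ⟨h3, h5⟩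
    · exfalso
      have h := eq_zero_of_forall_right c t hJ (Pi.single i 1) fun a b r => by
        rw [hsplit, hBi, (hX i).2, add_zero]
      simpa using congr_fun h i
  -- the vectors `n_{jk}`, `m_{il}` and the pairing `B`
  set n : Fin 4 → Fin 4 → ι → K := fun j k r => t r (0, Pi.single j 1) (Pi.single k 1, 0)
    with hn
  set m : Fin 4 → Fin 4 → ι → K := fun i l r => t r (Pi.single i 1, 0) (0, Pi.single l 1)
    with hm
  set B : (ι → K) → (ι → K) → K := fun x y => ∑ r, c r * x r * y r with hB
  have Bsymm : ∀ x y, B x y = B y x := fun x y => Finset.sum_congr rfl fun r _ => by ring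
  have Bzero : ∀ y, B 0 y = 0 := fun y => by simp [hB]
  have hother : ∀ j : Fin 4, ∃ k, j ≠ k := by decide
  have njj : ∀ j, n j j = 0 := fun j => by
    obtain ⟨k, hk⟩ := hother j
    funext r
    exact (hFA j k hk).1 r
  have nsym : ∀ j k, n k j = n j k := fun j k => by
    rcases eq_or_ne j k with rfl | h
    · rfl
    · funext r
      exact (hFA j k h).2 r
  -- Gram pairing against the `m`'s
  have gram : ∀ i j k l : Fin 4, 2 * B (n j k) (m i l) =
      (Matrix.of ![Pi.single i (1 : K), Pi.single j 1, Pi.single k 1, Pi.single l 1]).permanent := by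
    intro i j k l
    have h := polar c t hJ (Pi.single i 1) (Pi.single j 1) (Pi.single k 1) 0 0 (Pi.single l 1)
    rw [per_zero_row₂, add_zero] at h
    have h1 : ∀ r, t r (Pi.single i 1, Pi.single j 1) (Pi.single k 1, 0) = n j k r := fun r => by
      rw [hsplit, (hX k).1, zero_add]
    have h2 : ∀ r, t r (Pi.single i 1, Pi.single j 1) (0, Pi.single l 1) = m i l r := fun r => by
      rw [hsplit, (hX l).2, add_zero]
    simp_rw [h1, h2] at h
    exact h
  -- isotropy relations among the `n`'s
  have iso : ∀ j j' k k' : Fin 4, B (n j k) (n j' k') + B (n j' k) (n j k') = 0 := by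
    intro j j' k k'
    have hd : ∀ jj : Fin 4, B (n jj k) (n jj k') = 0 := fun jj => by
      have h' := polar c t hJ 0 (Pi.single jj 1) (Pi.single k 1) 0 (Pi.single k' 1) 0
      rw [per_zero_row₀, per_zero_row₀, add_zero] at h'
      exact (mul_eq_zero.1 h').resolve_left two_ne_zero
    have h := polar c t hJ 0 (Pi.single j 1 + Pi.single j' 1) (Pi.single k 1) 0 (Pi.single k' 1) 0
    rw [per_zero_row₀, per_zero_row₀, add_zero] at h
    have h1 : ∀ r (kk : Fin 4), t r (0, Pi.single j 1 + Pi.single j' 1) (Pi.single kk 1, 0) =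
        n j kk r + n j' kk r := fun r kk => by
      rw [show (((0 : Fin 4 → K), (Pi.single j 1 + Pi.single j' 1 : Fin 4 → K)) :
          (Fin 4 → K) × (Fin 4 → K)) = (0, Pi.single j 1) + (0, Pi.single j' 1) by simp,
        map_add, LinearMap.add_apply]
    simp_rw [h1] at h
    have hexp : ∑ r, c r * (n j k r + n j' k r) * (n j k' r + n j' k' r) =
        B (n j k) (n j k') + (B (n j k) (n j' k') + B (n j' k) (n j k')) + B (n j' k) (n j' k') := by
      rw [hB, ← Finset.sum_add_distrib, ← Finset.sum_add_distrib, ← Finset.sum_add_distrib]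
      exact Finset.sum_congr rfl fun r _ => by ring
    rw [hexp, hd j, hd j', zero_add, add_zero] at h
    exact (mul_eq_zero.1 h).resolve_left two_ne_zero
  have diag : ∀ j k k' : Fin 4, B (n j k) (n j k') = 0 := fun j k k' => by
    have h := iso j j k k'
    linear_combination h / 2
  have isoAll : ∀ j k j' k' : Fin 4, B (n j k) (n j' k') = 0 := by
    intro j k j' k'
    by_cases hjk : j = k
    · rw [hjk, njj, Bzero]
    by_cases hjk' : j' = k'
    · rw [hjk', njj, Bsymm, Bzero]
    by_cases h1 : j = j'
    · rw [← h1]; exact diag j k k'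
    by_cases h2 : j = k'
    · rw [h2, nsym k' j']; exact diag k' k j'
    by_cases h3 : k = j'
    · rw [← h3, nsym k j]; exact diag k j k'
    by_cases h4 : k = k'
    · rw [← h4, nsym k j, nsym k j']; exact diag k j j'
    -- all four indices distinct: the three pairings
    have e1 := iso j j' k k'
    have e2 := iso j k j' k'
    have e3 := iso j k' k j'
    rw [nsym j' k] at e2
    rw [nsym j' k', nsym k k', Bsymm (n k k')] at e3
    linear_combination (e1 + e3 - e2) / 2
  -- six `n`'s and six `m`'s in complementary order
  set N6 : Fin 6 → ι → K := ![n 0 1, n 0 2, n 0 3, n 1 2, n 1 3, n 2 3] with hN6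
  set M6 : Fin 6 → ι → K := ![m 2 3, m 1 3, m 1 2, m 0 3, m 0 2, m 0 1] with hM6
  have h6 : ∀ S : Fin 6, S = 0 ∨ S = 1 ∨ S = 2 ∨ S = 3 ∨ S = 4 ∨ S = 5 := by decide
  have gram6 : ∀ S S' : Fin 6, 2 * B (N6 S) (M6 S') = if S = S' then 1 else 0 := by
    intro S S'
    rcases h6 S with rfl | rfl | rfl | rfl | rfl | rfl <;>
      rcases h6 S' with rfl | rfl | rfl | rfl | rfl | rfl <;>
      · simp only [hN6, hM6, Matrix.cons_val]
        rw [gram, permanent_of_rows]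
        simp
  have iso6 : ∀ S S' : Fin 6, B (N6 S) (N6 S') = 0 := by
    intro S S'
    rcases h6 S with rfl | rfl | rfl | rfl | rfl | rfl <;>
      rcases h6 S' with rfl | rfl | rfl | rfl | rfl | rfl <;>
      · simp only [hN6, Matrix.cons_val]
        exact isoAll _ _ _ _
  -- `ψ x = (2 B (N6 S) x)_S`, `χ x = (2 B x (M6 S))_S`
  let ψ : (ι → K) →ₗ[K] (Fin 6 → K) :=
    { toFun := fun x S => 2 * B (N6 S) x
      map_add' := fun x y => by
        funext S
        simp only [hB, Pi.add_apply, mul_add, Finset.sum_add_distrib]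
      map_smul' := fun s x => by
        funext S
        simp only [hB, Pi.smul_apply, smul_eq_mul, RingHom.id_apply, Finset.mul_sum]
        exact Finset.sum_congr rfl fun r _ => by ring }
  have hψ : ∀ x S, ψ x S = 2 * B (N6 S) x := fun x S => rfl
  let χ : (ι → K) →ₗ[K] (Fin 6 → K) :=
    { toFun := fun x S => 2 * B x (M6 S)
      map_add' := fun x y => by
        funext S
        simp only [hB, Pi.add_apply, mul_add, add_mul, Finset.sum_add_distrib]
      map_smul' := fun s x => by
        funext S
        simp only [hB, Pi.smul_apply, smul_eq_mul, RingHom.id_apply, Finset.mul_sum]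
        exact Finset.sum_congr rfl fun r _ => by ring }
  have hχ : ∀ x S, χ x S = 2 * B x (M6 S) := fun x S => rfl
  have hψM : ∀ S', ψ (M6 S') = Pi.single S' 1 := fun S' => by
    funext S
    rw [hψ, gram6, Pi.single_apply]
  have hψN : ∀ S', ψ (N6 S') = 0 := fun S' => by
    funext S
    rw [hψ, iso6, mul_zero, Pi.zero_apply]
  have hχN : ∀ S', χ (N6 S') = Pi.single S' 1 := fun S' => by
    funext S
    rw [hχ, gram6, Pi.single_apply]
    by_cases h : S' = S
    · rw [if_pos h, if_pos h.symm]
    · rw [if_neg h, if_neg (Ne.symm h)]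
  have hsum : ∀ v : Fin 6 → K, ∑ S, v S • (Pi.single S (1 : K) : Fin 6 → K) = v := fun v => by
    funext S
    simp [Finset.sum_apply, Pi.single_apply]
  -- `ψ` is onto, so `dim ker ψ = |ι| - 6`
  have hrange : LinearMap.range ψ = ⊤ := by
    rw [LinearMap.range_eq_top]
    intro v
    refine ⟨∑ S, v S • M6 S, ?_⟩
    rw [map_sum]
    simp_rw [map_smul, hψM]
    exact hsum v
  have hker : finrank K (LinearMap.ker ψ) + 6 = Fintype.card ι := by
    have h := LinearMap.finrank_range_add_finrank_ker ψ
    rw [hrange, finrank_top, finrank_fintype_fun_eq_card, finrank_fintype_fun_eq_card,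
      Fintype.card_fin] at h
    omega
  -- the span of the `N6 S` lies in `ker ψ` but maps onto `K⁶` under `χ`
  set Nsp := Submodule.span K (Set.range N6) with hNsp
  have hle : Nsp ≤ LinearMap.ker ψ := by
    rw [hNsp, Submodule.span_le]
    rintro _ ⟨S', rfl⟩
    exact LinearMap.mem_ker.2 (hψN S')
  have h2 : finrank K Nsp ≤ finrank K (LinearMap.ker ψ) := Submodule.finrank_mono hle
  have htop : (⊤ : Submodule K (Fin 6 → K)) ≤ Nsp.map χ := by
    intro v _
    rw [← hsum v]
    refine Submodule.sum_mem _ fun S _ => Submodule.smul_mem _ _ ?_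
    exact ⟨N6 S, Submodule.subset_span ⟨S, rfl⟩, hχN S⟩
  have h6 : 6 ≤ finrank K Nsp := by
    have h := Submodule.finrank_mono htop
    rw [finrank_top, finrank_fintype_fun_eq_card, Fintype.card_fin] at h
    exact h.trans (Submodule.finrank_map_le χ Nsp)
  omega

/-- **No joint family with at most nine squares and non-zero weights.** [folklore] -/
theorem false_of_joint_of_ne_zero [CharZero K] [DecidableEq ι] (hι : Fintype.card ι ≤ 9)
    (c : ι → K) (hc : ∀ r, c r ≠ 0)
    (t : ι → (((Fin 4 → K) × (Fin 4 → K)) →ₗ[K] ((Fin 4 → K) × (Fin 4 → K)) →ₗ[K] K))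
    (hJ : ∀ a b y₂ y₃ : Fin 4 → K,
      ∑ r, c r * (t r (a, b) (y₂, y₃)) ^ 2 = (Matrix.of ![a, b, y₂, y₃]).permanent) : False := by
  rcases allX_or_allY hι c hc t hJ with hX | hY
  · exact false_of_allX hι c hc t hJ hX
  · -- swap the roles of `y₂` and `y₃`
    set t' : ι → (((Fin 4 → K) × (Fin 4 → K)) →ₗ[K] ((Fin 4 → K) × (Fin 4 → K)) →ₗ[K] K) :=
      fun r => (t r).compl₂ (LinearEquiv.prodComm K (Fin 4 → K) (Fin 4 → K)).toLinearMap with ht'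
    have hev : ∀ r (u : (Fin 4 → K) × (Fin 4 → K)) (v w : Fin 4 → K),
        t' r u (v, w) = t r u (w, v) := fun r u v w => rfl
    refine false_of_allX hι c hc t' (hJ_yswap c t hJ) fun k => ⟨fun a r => ?_, fun b r => ?_⟩
    · rw [hev]; exact (hY k).1 a r
    · rw [hev]; exact (hY k).2 b r

/-- **Inner rank `≥ 10` for the `2 | 2` row split of `per_4`.**  Over a field of characteristic
`0`, for any index type `ι` with `|ι| ≤ 9` there are no `c : ι → K` and bilinear forms `t_r` on
`(K⁴ × K⁴) × (K⁴ × K⁴)` with `Σ_r c_r t_r((a,b),(y₂,y₃))² = per (a; b; y₂; y₃)` for all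
`a, b, y₂, y₃` (zero weights are discarded first). [folklore] -/
theorem false_of_joint_nine_squares [CharZero K] [DecidableEq ι] (hι : Fintype.card ι ≤ 9)
    (c : ι → K)
    (t : ι → (((Fin 4 → K) × (Fin 4 → K)) →ₗ[K] ((Fin 4 → K) × (Fin 4 → K)) →ₗ[K] K))
    (hJ : ∀ a b y₂ y₃ : Fin 4 → K,
      ∑ r, c r * (t r (a, b) (y₂, y₃)) ^ 2 = (Matrix.of ![a, b, y₂, y₃]).permanent) : False := by
  classical
  -- restrict to the non-zero weights
  let ι' := {r : ι // c r ≠ 0}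
  have hι' : Fintype.card ι' ≤ 9 := (Fintype.card_subtype_le _).trans hι
  refine false_of_joint_of_ne_zero (ι := ι') hι' (fun r => c r.1) (fun r => r.2) (fun r => t r.1)
    fun a b y₂ y₃ => ?_
  have hsub : ∑ r : ι', c r.1 * (t r.1 (a, b) (y₂, y₃)) ^ 2 =
      ∑ r ∈ Finset.univ.filter (fun r => c r ≠ 0), c r * (t r (a, b) (y₂, y₃)) ^ 2 :=
    (Finset.sum_subtype (Finset.univ.filter (fun r => c r ≠ 0)) (fun x => by simp)
      (fun r => c r * (t r (a, b) (y₂, y₃)) ^ 2)).symm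
  have hzero : ∑ r ∈ Finset.univ.filter (fun r => ¬ c r ≠ 0), c r * (t r (a, b) (y₂, y₃)) ^ 2 = 0 :=
    Finset.sum_eq_zero fun r hr => by
      simp only [ne_eq, Decidable.not_not, Finset.mem_filter, Finset.mem_univ, true_and] at hr
      rw [hr, zero_mul]
  have hsplit := Finset.sum_filter_add_sum_filter_not Finset.univ (fun r => c r ≠ 0)
    (fun r => c r * (t r (a, b) (y₂, y₃)) ^ 2)
  rw [hzero, add_zero] at hsplit
  rw [hsub, hsplit, hJ]

/-- **No joint `9`-square family** (the `Fin 9` instance). [folklore] -/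
theorem not_exists_joint_nine_squares [CharZero K] :
    ¬ ∃ (c : Fin 9 → K)
        (t : Fin 9 → (((Fin 4 → K) × (Fin 4 → K)) →ₗ[K] ((Fin 4 → K) × (Fin 4 → K)) →ₗ[K] K)),
      ∀ a b y₂ y₃ : Fin 4 → K,
        ∑ r, c r * (t r (a, b) (y₂, y₃)) ^ 2 = (Matrix.of ![a, b, y₂, y₃]).permanent :=
  fun ⟨c, t, hJ⟩ => false_of_joint_nine_squares (by rw [Fintype.card_fin]) c t hJ

end Summit.ValiantsHypothesis.ValiantsHypothesis.Theorems.SymPencilPerFourInnerRankTen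

end
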